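import Summits.ValiantsHypothesis.ValiantsHypothesis.Theorems.BarrierLeverKRSTNoGoBelow12cOnB05Reduction

/-!
# Route BarrierLever — item `KRSTNoGoBelow12cOnB05` (stmt-ValiantsHypothesis-19340), part 5/6:
# the [B05]-at-`p` hypotheses, ADMISSIBLE position sets, and the conditional no-go at one prime

Lean text authored by the cell planner seat `valiant-natproofs-p2` (gen 3, HOME/RowZero-p2g3.lean v5
§E.9–§E.11, referee REF-P2G3B / REF-ITEMS-g9 PASS; memo ROUTE-MEMO-p2-g3 §4d), landed by the
prover seat.

* §E.9 `OneTermBound p L t K₀` / `TwoTermBound p L t K₀` — the analytic INPUT isolated as predicates: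
  for `θ` (resp. `θ₁, θ₂, θ₁θ₂⁻¹`) of multiplicative order `> L` and nonzero coefficients, the orbit
  sums `Σ_{s<t} ψ(a θ^{s+1})` (resp. two-term) have norm `≤ K₀`. Bourgain 2005 (JAMS 18, Thm 2 with
  (1.19)–(1.20)) gives this with `L = p^ε`, `t > p^ε`, `K₀ = p^{-δ} t`; HERE IT IS A HYPOTHESIS.
  `Admissible hmp L A` — matrix positions whose abscissae are nonzero of order `> L` with pairwise
  ratios of order `> L`; **`krst_not_idealSuccinct_of_B05At`** — with `I = A × 𝔽_p^*`, the two bounds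
  and two numeric inequalities give "KRST's generator is not ideal-succinct for `SmallCircuits ℂ n b`".
* §E.10 `exists_indep_of_degree_le` (greedy independent set in a graph of bounded degree),
  `smallOrd`, `card_smallOrd_le` (at most `L²` elements of order `≤ L`), **`exists_admissible`** — an
  admissible `A` with `m² ≤ |A|(2L²+1) + (L²+1)`.
* §E.11 `two_pow_le_card_simplex`, **`krst_not_idealSuccinct_of_B05At'`** — the all-`ℕ` form with four
  numeric inequalities.

WHAT THIS IS NOT: [B05] is not proved; nothing unconditional beyond part 4; nothing for `b ≥ 12c`.

References: [Bourgain2005] Thm 2, (1.19)–(1.20); [KumarRamyaSaptharishiTengse2022] §3.5.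
-/

-- layout Summits/ValiantsHypothesis/ValiantsHypothesis forces the duplicated namespace component
set_option linter.dupNamespace false

noncomputable section

namespace Summit.ValiantsHypothesis.ValiantsHypothesis.Theorems.BarrierLever.KRSTNoGoBelow12cOnB05

open Literature.Barriers.ValiantsHypothesis Literature.Computability.AlgebraicComplexity MvPolynomial
open Summit.ValiantsHypothesis.ValiantsHypothesis.Theorems.BarrierLever.SuccinctHittingSetsForVP
open Summit.ValiantsHypothesis.ValiantsHypothesis.Theorems.BarrierLever.SuccinctHittingSetsForVP.KRSTEdge
open Summit.ValiantsHypothesis.ValiantsHypothesis.Theorems.BarrierLever.KRSTNoGoBelow12cOnB05.CharSum (ψ)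
open Literature.Computability.MetaComplexity (eval_ofFn_eq_sum leastPrimeGe leastPrimeGe_spec leastPrimeGe_le)

variable {p : ℕ} [Fact p.Prime]

/-! ### E.9 Isolating the analytic input: [B05]-at-`p` two-term hypotheses with order conditions,
admissible position sets, frequencies `λ ∈ (ZMod p)ˣ` (memo §4d (e′): everything except the
admissible-set COUNT, [B05] itself and two numeric inequalities) -/

/-- [B05]-at-`p`, `r = 1`: for `θ ≠ 0` of multiplicative order `> L` and `a ≠ 0`, the short orbit sum
`Σ_{s=1}^{t} ψ(a θ^s)` has norm `≤ K₀`. (Bourgain 2005 Thm 2 gives this with `L = p^ε`, `t > p^ε`,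
`K₀ = p^{-δ} t`; here it is a hypothesis.) -/
def OneTermBound (p : ℕ) [Fact p.Prime] (L t K₀ : ℕ) : Prop :=
  ∀ θ : ZMod p, θ ≠ 0 → L < orderOf θ → ∀ a : ZMod p, a ≠ 0 →
    ‖∑ s : Fin t, (ψ (a * θ ^ ((s : ℕ) + 1)) : ℂ)‖ ≤ K₀

/-- [B05]-at-`p`, `r = 2`: two-term orbit sums under the order conditions on `θ₁, θ₂, θ₁θ₂⁻¹`. -/
def TwoTermBound (p : ℕ) [Fact p.Prime] (L t K₀ : ℕ) : Prop :=
  ∀ θ₁ θ₂ : ZMod p, θ₁ ≠ 0 → θ₂ ≠ 0 → L < orderOf θ₁ → L < orderOf θ₂ →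
    L < orderOf (θ₁ * θ₂⁻¹) → ∀ a₁ a₂ : ZMod p, a₁ ≠ 0 → a₂ ≠ 0 →
    ‖∑ s : Fin t, (ψ (a₁ * θ₁ ^ ((s : ℕ) + 1) + a₂ * θ₂ ^ ((s : ℕ) + 1)) : ℂ)‖ ≤ K₀

/-- Admissible sets of matrix positions: abscissae nonzero, of order `> L`, with pairwise ratios of
order `> L`. -/
def Admissible {m : ℕ} (hmp : m * m ≤ p) (L : ℕ) (A : Finset (Fin m × Fin m)) : Prop :=
  (∀ q ∈ A, ab hmp q ≠ 0 ∧ L < orderOf (ab hmp q)) ∧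
  (∀ q ∈ A, ∀ q' ∈ A, q ≠ q' → L < orderOf (ab hmp q * (ab hmp q')⁻¹))

/-- **The [B05]-conditional no-go at one `p` (memo §4d).** Given the one- and two-term bounds at `p`
with window `t = n - 1` and threshold `L`, an admissible position set `A`, and the two numeric
inequalities `(|A|(p-1) - 1)·C(K₀+1+n, n) < C(2n,n)` and `4n^b + 1 < |A|(p-1)`, KRST's generator is
not ideal-succinct for `SmallCircuits ℂ n b`. (Index set `I = A × (ZMod p)ˣ`; the `s = 0` term of each
pairwise sum is a root of unity, whence `K = K₀ + 1`.) -/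
theorem krst_not_idealSuccinct_of_B05At {n m b : ℕ} (hmp : m * m ≤ p) (hnp : n < p) (L K₀ : ℕ)
    (h1 : OneTermBound p L (n - 1) K₀) (h2 : TwoTermBound p L (n - 1) K₀)
    (A : Finset (Fin m × Fin m)) (hA : Admissible hmp L A)
    (hdom : ((A.card * (p - 1) - 1 : ℕ) : ℝ) * ((K₀ + 1 + n).choose n : ℝ) <
      (CharSum.simplex n n).card)
    (hK : 4 * n ^ b + 1 < A.card * (p - 1)) :
    ¬ IsIdealSuccinctGenerator (degLEMonomials n) (SmallCircuits ℂ n b) (krstGen ℂ p n hmp) := by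
  classical
  have hcard : Fintype.card (↥A × (ZMod p)ˣ) = A.card * (p - 1) := by
    rw [Fintype.card_prod, Fintype.card_coe, ZMod.card_units]
  refine krst_not_idealSuccinct_of_twoTermBounds_full (I := ↥A × (ZMod p)ˣ) hmp
    (fun α => (α.1 : Fin m × Fin m)) (fun α => (α.2 : ZMod p)) (K₀ + 1) ?_ ?_ ?_
  · intro α β hne i hi1 hin
    obtain ⟨n', rfl⟩ : ∃ n', n = n' + 1 := ⟨n - 1, by omega⟩
    simp only [Nat.add_sub_cancel] at h1 h2
    have hp2 : 2 ≤ p := (Fact.out : p.Prime).two_le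
    have hi0 : (i : ZMod p) ≠ 0 := by
      intro h
      have hdvd := (ZMod.natCast_eq_zero_iff i p).mp h
      exact absurd (Nat.le_of_dvd (by omega) hdvd) (by omega)
    have hαA := hA.1 _ α.1.2
    have hβA := hA.1 _ β.1.2
    rw [Fin.sum_univ_succ]
    simp only [Fin.val_zero, pow_zero, mul_one, Fin.val_succ]
    refine (norm_add_le _ _).trans ?_
    rw [AddChar.norm_apply, Nat.cast_add, Nat.cast_one, add_comm (K₀ : ℝ) 1]
    refine add_le_add le_rfl ?_
    by_cases hq : (α.1 : Fin m × Fin m) = (β.1 : Fin m × Fin m)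
    · -- same abscissa: a one-term sum with coefficient `i (λ_β - λ_α) ≠ 0`
      have hlam : (α.2 : ZMod p) ≠ (β.2 : ZMod p) := by
        intro h
        exact hne (Prod.ext (Subtype.ext hq) (Units.ext h))
      have hcoef : (i : ZMod p) * ((β.2 : ZMod p) - (α.2 : ZMod p)) ≠ 0 :=
        mul_ne_zero hi0 (sub_ne_zero.mpr (Ne.symm hlam))
      have := h1 (ab hmp (α.1 : Fin m × Fin m)) hαA.1 hαA.2 _ hcoef
      rw [hq] at this ⊢
      refine le_of_eq_of_le ?_ this
      congr 1
      refine Finset.sum_congr rfl fun s _ => ?_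
      congr 1
      ring
    · -- different abscissae: a genuine two-term sum
      have hrat := hA.2 _ β.1.2 _ α.1.2 (fun h => hq (h.symm))
      have hc1 : (i : ZMod p) * (β.2 : ZMod p) ≠ 0 := mul_ne_zero hi0 (Units.ne_zero _)
      have hc2 : -((i : ZMod p) * (α.2 : ZMod p)) ≠ 0 :=
        neg_ne_zero.mpr (mul_ne_zero hi0 (Units.ne_zero _))
      have := h2 (ab hmp (β.1 : Fin m × Fin m)) (ab hmp (α.1 : Fin m × Fin m)) hβA.1 hαA.1 hβA.2
        hαA.2 hrat _ _ hc1 hc2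
      refine le_of_eq_of_le ?_ this
      congr 1
      refine Finset.sum_congr rfl fun s _ => ?_
      congr 1
      ring
  · rw [hcard]
    exact hdom
  · rw [hcard]
    exact hK

/-! ### E.10 The admissible-set COUNT (memo §4d (e′)): a greedy independent set among the `m²`
abscissae; `m² ≤ |A|·(2L²+1) + (L²+1)` -/

section Greedy

variable {α : Type*} [DecidableEq α] (r : α → α → Prop) [DecidableRel r]

/-- Greedy independent set: if every vertex of `V` has at most `Δ` in- or out-neighbours in `V`, there is
an `S ⊆ V`, independent for `r` in both directions, with `|V| ≤ |S|·(Δ+1)`. -/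
theorem exists_indep_of_degree_le (Δ : ℕ) (V : Finset α)
    (hdeg : ∀ x ∈ V, (V.filter fun y => r x y ∨ r y x).card ≤ Δ) :
    ∃ S ⊆ V, (∀ x ∈ S, ∀ y ∈ S, x ≠ y → ¬ r x y) ∧ V.card ≤ S.card * (Δ + 1) := by
  induction' hN : V.card using Nat.strong_induction_on with N ih generalizing V
  rcases V.eq_empty_or_nonempty with hV | ⟨x, hx⟩
  · exact ⟨∅, Finset.empty_subset _, by simp, by rw [← hN, hV]; simp⟩
  · set V' := (V.erase x).filter fun y => ¬ (r x y ∨ r y x) with hV'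
    have hV'sub : V' ⊆ V := (Finset.filter_subset _ _).trans (Finset.erase_subset _ _)
    have hlt : V'.card < N := by
      rw [← hN]
      exact lt_of_le_of_lt (Finset.card_le_card (Finset.filter_subset _ _))
        (Finset.card_erase_lt_of_mem hx)
    have hdeg' : ∀ y ∈ V', (V'.filter fun z => r y z ∨ r z y).card ≤ Δ := fun y hy =>
      (Finset.card_le_card (Finset.filter_subset_filter _ hV'sub)).trans (hdeg y (hV'sub hy))
    obtain ⟨S', hS'V', hind, hcard⟩ := ih V'.card hlt V' hdeg' rfl
    have hxS' : x ∉ S' := fun h => by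
      have := hS'V' h
      rw [hV', Finset.mem_filter] at this
      exact Finset.ne_of_mem_erase this.1 rfl
    refine ⟨insert x S', ?_, ?_, ?_⟩
    · exact Finset.insert_subset hx (hS'V'.trans hV'sub)
    · intro a ha b hb hab
      rw [Finset.mem_insert] at ha hb
      rcases ha with rfl | ha <;> rcases hb with rfl | hb
      · exact absurd rfl hab
      · have := hS'V' hb
        rw [hV', Finset.mem_filter] at this
        exact fun h => this.2 (Or.inl h)
      · have := hS'V' ha
        rw [hV', Finset.mem_filter] at this
        exact fun h => this.2 (Or.inr h)
      · exact hind a ha b hb hab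
    · rw [Finset.card_insert_of_notMem hxS']
      have h1 : V.card = (V.erase x).card + 1 := (Finset.card_erase_add_one hx).symm
      have h2 : (V.erase x).card ≤ V'.card + Δ := by
        have hsplit := Finset.card_filter_add_card_filter_not
          (s := V.erase x) (fun y => r x y ∨ r y x)
        have h3 : ((V.erase x).filter fun y => r x y ∨ r y x).card ≤ Δ :=
          (Finset.card_le_card (Finset.filter_subset_filter _ (Finset.erase_subset _ _))).trans
            (hdeg x hx)
        rw [hV']
        omega
      nlinarith

end Greedy

/-- Nonzero elements of `ZMod p` of multiplicative order `≤ L`. -/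
def smallOrd (p : ℕ) [Fact p.Prime] (L : ℕ) : Finset (ZMod p) :=
  Finset.univ.filter fun x => x ≠ 0 ∧ orderOf x ≤ L

/-- Nonzero elements of `ZMod p` have positive multiplicative order. -/
theorem orderOf_pos_of_ne_zero {x : ZMod p} (hx : x ≠ 0) : 0 < orderOf x := by
  have hp2 : 2 ≤ p := (Fact.out : p.Prime).two_le
  exact (isOfFinOrder_iff_pow_eq_one.mpr ⟨p - 1, by omega, ZMod.pow_card_sub_one_eq_one hx⟩).orderOf_pos

/-- `|smallOrd p L| ≤ L²`: an element of order `d` is a `d`-th root of unity, of which there are `≤ d`. -/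
theorem card_smallOrd_le (L : ℕ) : (smallOrd p L).card ≤ L * L := by
  classical
  have hsub : smallOrd p L ⊆ (Finset.range L).biUnion
      fun d => (Polynomial.nthRoots (d + 1) (1 : ZMod p)).toFinset := by
    intro x hx
    simp only [smallOrd, Finset.mem_filter, Finset.mem_univ, true_and] at hx
    have h0 := orderOf_pos_of_ne_zero hx.1
    refine Finset.mem_biUnion.mpr ⟨orderOf x - 1, Finset.mem_range.mpr (by omega), ?_⟩
    rw [Multiset.mem_toFinset, Nat.sub_add_cancel h0, Polynomial.mem_nthRoots h0]
    exact pow_orderOf_eq_one x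
  refine (Finset.card_le_card hsub).trans ((Finset.card_biUnion_le).trans ?_)
  have : ∀ d ∈ Finset.range L, ((Polynomial.nthRoots (d + 1) (1 : ZMod p)).toFinset).card ≤ L :=
    fun d hd => (Multiset.toFinset_card_le _).trans
      ((Polynomial.card_nthRoots _ _).trans (by have := Finset.mem_range.mp hd; omega))
  refine (Finset.sum_le_card_nsmul _ _ _ this).trans ?_
  simp

/-- **Admissible sets exist in quantity**: among the `m²` matrix abscissae `{0,…,m²-1} ⊂ ZMod p` there is
an admissible set `A` (orders and pairwise order-ratios `> L`) with `m² ≤ |A|·(2L²+1) + (L²+1)`. -/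
theorem exists_admissible {m : ℕ} (hmp : m * m ≤ p) (L : ℕ) :
    ∃ A : Finset (Fin m × Fin m), Admissible hmp L A ∧
      m * m ≤ A.card * (2 * (L * L) + 1) + (L * L + 1) := by
  classical
  -- the good vertices
  set V := (Finset.univ : Finset (Fin m × Fin m)).filter
    fun q => ab hmp q ≠ 0 ∧ L < orderOf (ab hmp q) with hV
  -- adjacency: ratio of small order
  let r : Fin m × Fin m → Fin m × Fin m → Prop := fun q q' => orderOf (ab hmp q * (ab hmp q')⁻¹) ≤ L
  -- out-degree bound via the injection `q' ↦ a_q a_{q'}⁻¹` into `smallOrd`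
  have hout : ∀ q ∈ V, (V.filter fun q' => r q q').card ≤ L * L := by
    intro q hq
    have hq0 : ab hmp q ≠ 0 := ((Finset.mem_filter.mp hq).2).1
    refine le_trans ?_ (card_smallOrd_le (p := p) L)
    refine Finset.card_le_card_of_injOn (fun q' => ab hmp q * (ab hmp q')⁻¹) ?_ ?_
    · intro q' hq'
      rw [Finset.mem_coe, Finset.mem_filter] at hq'
      have hq'0 : ab hmp q' ≠ 0 := ((Finset.mem_filter.mp hq'.1).2).1
      simp only [smallOrd, Finset.coe_filter, Finset.mem_univ, true_and, Set.mem_setOf_eq]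
      exact ⟨mul_ne_zero hq0 (inv_ne_zero hq'0), hq'.2⟩
    · intro q₁ hq₁ q₂ hq₂ h
      rw [Finset.mem_coe, Finset.mem_filter] at hq₁ hq₂
      have h1 : ab hmp q₁ ≠ 0 := ((Finset.mem_filter.mp hq₁.1).2).1
      have h2 : ab hmp q₂ ≠ 0 := ((Finset.mem_filter.mp hq₂.1).2).1
      have : (ab hmp q₁)⁻¹ = (ab hmp q₂)⁻¹ := mul_left_cancel₀ hq0 h
      exact ab_injective hmp (inv_injective this)
  have hin : ∀ q ∈ V, (V.filter fun q' => r q' q).card ≤ L * L := by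
    intro q hq
    have hq0 : ab hmp q ≠ 0 := ((Finset.mem_filter.mp hq).2).1
    refine le_trans ?_ (card_smallOrd_le (p := p) L)
    refine Finset.card_le_card_of_injOn (fun q' => ab hmp q' * (ab hmp q)⁻¹) ?_ ?_
    · intro q' hq'
      rw [Finset.mem_coe, Finset.mem_filter] at hq'
      have hq'0 : ab hmp q' ≠ 0 := ((Finset.mem_filter.mp hq'.1).2).1
      simp only [smallOrd, Finset.coe_filter, Finset.mem_univ, true_and, Set.mem_setOf_eq]
      exact ⟨mul_ne_zero hq'0 (inv_ne_zero hq0), hq'.2⟩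
    · intro q₁ hq₁ q₂ hq₂ h
      exact ab_injective hmp (mul_right_cancel₀ (inv_ne_zero hq0) h)
  have hdeg : ∀ q ∈ V, (V.filter fun q' => r q q' ∨ r q' q).card ≤ 2 * (L * L) := by
    intro q hq
    have hsub : (V.filter fun q' => r q q' ∨ r q' q) ⊆
        (V.filter fun q' => r q q') ∪ (V.filter fun q' => r q' q) := by
      intro y hy
      rw [Finset.mem_union]
      rcases Finset.mem_filter.mp hy with ⟨hyV, h | h⟩
      · exact Or.inl (Finset.mem_filter.mpr ⟨hyV, h⟩)
      · exact Or.inr (Finset.mem_filter.mpr ⟨hyV, h⟩)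
    have h1 := hout q hq
    have h2 := hin q hq
    exact (Finset.card_le_card hsub).trans ((Finset.card_union_le _ _).trans (by omega))
  obtain ⟨S, hSV, hind, hcard⟩ := exists_indep_of_degree_le r (2 * (L * L)) V hdeg
  -- the complement of `V` is small: it injects via `ab` into `{0} ∪ smallOrd`
  have hVc : (Finset.univ.filter fun q : Fin m × Fin m =>
      ¬ (ab hmp q ≠ 0 ∧ L < orderOf (ab hmp q))).card ≤ L * L + 1 := by
    refine le_trans ?_ ((Finset.card_insert_le (0 : ZMod p) (smallOrd p L)).trans
      (by have := card_smallOrd_le (p := p) L; omega))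
    refine Finset.card_le_card_of_injOn (ab hmp) ?_ (fun q₁ _ q₂ _ h => ab_injective hmp h)
    intro q hq
    rw [Finset.mem_coe, Finset.mem_filter] at hq
    simp only [Finset.coe_insert, Set.mem_insert_iff, smallOrd, Finset.coe_filter, Finset.mem_univ,
      true_and, Set.mem_setOf_eq]
    by_cases h0 : ab hmp q = 0
    · exact Or.inl h0
    · exact Or.inr ⟨h0, not_lt.mp fun h => hq.2 ⟨h0, h⟩⟩
  have hVcard : m * m ≤ V.card + (L * L + 1) := by
    have hsplit := Finset.card_filter_add_card_filter_not
      (s := (Finset.univ : Finset (Fin m × Fin m))) (fun q => ab hmp q ≠ 0 ∧ L < orderOf (ab hmp q))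
    rw [Finset.card_univ, Fintype.card_prod, Fintype.card_fin] at hsplit
    rw [hV]
    omega
  refine ⟨S, ⟨fun q hq => (Finset.mem_filter.mp (hSV hq)).2, fun q hq q' hq' hne => ?_⟩, ?_⟩
  · exact not_le.mp (hind q hq q' hq' hne)
  · calc m * m ≤ V.card + (L * L + 1) := hVcard
      _ ≤ S.card * (2 * (L * L) + 1) + (L * L + 1) := by omega

/-! ### E.11 The final conditional form at one `p`: [B05]-at-`p` + four NUMERIC inequalities -/

/-- `2^N ≤ |simplex N n|` for `N ≤ n` (0/1 exponent vectors). Any exponential lower bound suffices for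
the asymptotics of memo §4d (ii), so we do not prove `|simplex n n| = C(2n,n)`. -/
theorem two_pow_le_card_simplex {N n : ℕ} (hNn : N ≤ n) : 2 ^ N ≤ (CharSum.simplex N n).card := by
  classical
  have hcard : (Finset.univ : Finset (Finset (Fin N))).card = 2 ^ N := by
    rw [Finset.card_univ, Fintype.card_finset, Fintype.card_fin]
  rw [← hcard]
  refine Finset.card_le_card_of_injOn (fun S t => if t ∈ S then 1 else 0) ?_ ?_
  · intro S _
    rw [Finset.mem_coe, CharSum.mem_simplex]
    calc ∑ i, (if i ∈ S then 1 else 0) = S.card := by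
          rw [Finset.sum_boole, Finset.filter_mem_eq_inter, Finset.univ_inter]; rfl
      _ ≤ N := (Finset.card_le_univ S).trans (by rw [Fintype.card_fin])
      _ ≤ n := hNn
  · intro S _ T _ h
    ext t
    have := congr_fun h t
    by_cases hS : t ∈ S <;> by_cases hT : t ∈ T <;> simp_all

/-- **KRST vs `SmallCircuits ℂ n b` at one prime, conditionally on [B05]-at-`p` (memo §4d; everything else
is kernel).** If the one- and two-term orbit-sum bounds hold at `p` with threshold `L` and window `n-1`,
and the numbers satisfy `N₀(2L²+1) + L² + 1 ≤ m²` (room for `N₀` admissible abscissae),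
`4n^b + 1 < N₀(p-1)` and `(N₀(p-1) - 1)·C(K₀+1+n, n) < 2^n`, then KRST's generator with block size `m` and
`m² ≤ p`, `n < p`, is not ideal-succinct (a fortiori not per-seed succinct) for `SmallCircuits ℂ n b`. -/
theorem krst_not_idealSuccinct_of_B05At' {n m b : ℕ} (hmp : m * m ≤ p) (hnp : n < p) (L K₀ N₀ : ℕ)
    (h1 : OneTermBound p L (n - 1) K₀) (h2 : TwoTermBound p L (n - 1) K₀)
    (hN₀ : N₀ * (2 * (L * L) + 1) + (L * L + 1) ≤ m * m)
    (hdom : (N₀ * (p - 1) - 1) * (K₀ + 1 + n).choose n < 2 ^ n)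
    (hK : 4 * n ^ b + 1 < N₀ * (p - 1)) :
    ¬ IsIdealSuccinctGenerator (degLEMonomials n) (SmallCircuits ℂ n b) (krstGen ℂ p n hmp) := by
  classical
  obtain ⟨A, hA, hAcard⟩ := exists_admissible hmp L
  have hle : N₀ ≤ A.card := by
    by_contra h
    have h' : A.card + 1 ≤ N₀ := by omega
    nlinarith
  obtain ⟨A₀, hA₀A, hA₀card⟩ := Finset.exists_subset_card_eq hle
  have hA₀ : Admissible hmp L A₀ :=
    ⟨fun q hq => hA.1 q (hA₀A hq), fun q hq q' hq' => hA.2 q (hA₀A hq) q' (hA₀A hq')⟩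
  refine krst_not_idealSuccinct_of_B05At hmp hnp L K₀ h1 h2 A₀ hA₀ ?_ (hA₀card ▸ hK)
  rw [hA₀card]
  have h2n := two_pow_le_card_simplex (le_refl n)
  calc ((N₀ * (p - 1) - 1 : ℕ) : ℝ) * ((K₀ + 1 + n).choose n : ℝ)
      = (((N₀ * (p - 1) - 1) * (K₀ + 1 + n).choose n : ℕ) : ℝ) := by push_cast; ring
    _ < ((2 ^ n : ℕ) : ℝ) := by exact_mod_cast hdom
    _ ≤ (CharSum.simplex n n).card := by exact_mod_cast h2n

end Summit.ValiantsHypothesis.ValiantsHypothesis.Theorems.BarrierLever.KRSTNoGoBelow12cOnB05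

end
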